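import Summits.BirchSwinnertonDyer.BirchSwinnertonDyer.Theses.PrintX6
import Literature.NumberTheory.EllipticCurves.AnalyticRankModularityProofs
import Literature.NumberTheory.EllipticCurves.ModularParametrizationTrustBaseProofs
import Literature.NumberTheory.EllipticCurves.ModularParametrizationDegreeHoldsProofs
import Literature.NumberTheory.EllipticCurves.ModularParametrizationBCDTProofs
import Literature.NumberTheory.EllipticCurves.SkinnerUrban2014.PAdicUnitPeriodRatioProofs
import Literature.NumberTheory.EllipticCurves.Wuthrich2014.ThreeAdicImageSupersingularProofs
import HarnessLib

/-!
# Route `PrintX6`, support item `PublishedInputsX6` (stmt-BirchSwinnertonDyer-20302): the SLIMMED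
# dependency list — the nine-conjunct print pack from SIX irredundant displayed inputs

D-0154 (2) INPUTS→UNCONDITIONAL, `INPUTS-LIST-2.md` §4 T1 «PackSlim» (cell `pub/bsd-wall`, seat
`bsd-inputs-pack-p1`). The support item `PublishedInputsX6` is the conjunction of nine REFEREED named
facts (Kobayashi 2003 Thm 1.2 / Thm 4.1, B. D. Kim 2013 Cor 3.15, the two Néron/newform period-unit
facts at `p ≥ 5` and `p = 3`, Wuthrich 2014 Lemma 20, modularity as parametrisation data, entireness
of `L(E,s)`, Gross–Zagier–Kolyvagin). Four of the nine are THEOREMS of the tree, outright or over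
other inputs the route already displays BY NAME:

* Wuthrich 2014 Lemma 20 is discharged:
  `Wuthrich2014.lemma20_surjective_threeAdic_of_semistable_holds`
  (`Literature/…/Wuthrich2014/ThreeAdicImageSupersingularProofs.lean`);
* both period-unit facts follow from Mazur 1978 Cor. 4.1
  (`ModularForms.mazur_not_dvd_maninConstant_of_odd` = the route's item 19383 `InputMazurManinOdd`) by
  `SkinnerUrban2014.realPeriodRat_eq_unit_mul_plusPeriod_of_mazur` / `…_three_of_mazur`
  (`Literature/…/SkinnerUrban2014/PAdicUnitPeriodRatioProofs.lean`);
* entireness of `L(E,s)` follows from the Modularity Theorem `ModularForms.exists_isNewformOf` (= item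
  19382 `InputNewformExistence`) by `WeierstrassCurve.hasEntireLFunction_rat_of_exists_isNewformOf`
  (`AnalyticRankModularityProofs.lean`), and so does the parametrisation datum, by
  `ModularForms.nonempty_modularParametrizationData_of_exists_isNewformOf`
  (`ModularParametrizationTrustBaseProofs.lean`) fed with the DISCHARGED rational Manin constant
  `ModularForms.IsNewformOf.exists_maninConstant_ne_zero_holds` (`ModularParametrizationDegreeHoldsProofs.lean`);
  conversely the datum returns the newform
  (`ModularForms.exists_isNewformOf_of_nonempty_modularParametrizationData`, `ModularParametrizationBCDTProofs.lean`).

Hence `PublishedInputsX6` follows from SIX items of this route, by name: `InputNewformExistence`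
(19382) [or the pack's own conjunct `InputModularParametrization` (19266)], `InputMazurManinOdd`
(19383), `InputKobayashiThm12` (19286), `InputKobayashiThm41` (19287), `InputKimCor315` (19288),
`InputGZK` (19921) — theorems `publishedInputsX6_of_slim` / `publishedInputsX6_of_slim_param`; and the
slimming is lossless up to Mazur's corollary (`inputNewformExistence_of_publishedInputsX6`).
HONEST FRAMING: pure glue over landed theorems; no cite-only fact is proved here, the six remaining
inputs stay print hypotheses, and the route stays conditional on them AS TYPED. Nothing here proves
BSD; BSD is not proved by any of this.
-/

set_option autoImplicit false
set_option linter.dupNamespace false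

namespace Summit.BirchSwinnertonDyer.BirchSwinnertonDyer.Theorems

open Literature.NumberTheory.EllipticCurves
open Summit.BirchSwinnertonDyer.BirchSwinnertonDyer.Theses.PrintX6

/-- **`PublishedInputsX6` from six irredundant displayed inputs, BY NAME** (route `PrintX6`, item
stmt-BirchSwinnertonDyer-20302; INPUTS-LIST-2 T1): the route items `InputNewformExistence` (Modularity
Theorem, newform form), `InputMazurManinOdd` (Mazur 1978 Cor. 4.1), `InputKobayashiThm12`,
`InputKobayashiThm41`, `InputKimCor315` and `InputGZK` imply the nine-conjunct pack: Wuthrich 2014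
Lemma 20 is the tree theorem `Wuthrich2014.lemma20_surjective_threeAdic_of_semistable_holds`, the two
period-unit conjuncts are `SkinnerUrban2014.realPeriodRat_eq_unit_mul_plusPeriod(_three)_of_mazur`,
the parametrisation datum is `ModularForms.nonempty_modularParametrizationData_of_exists_isNewformOf`
with the discharged Manin constant `ModularForms.IsNewformOf.exists_maninConstant_ne_zero_holds`, and
entireness is `WeierstrassCurve.hasEntireLFunction_rat_of_exists_isNewformOf`. Pure glue; the six
hypotheses remain print inputs. [folklore] -/
theorem publishedInputsX6_of_slim
    (hmod : InputNewformExistence) (hMazur : InputMazurManinOdd)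
    (hK12 : InputKobayashiThm12) (hK41 : InputKobayashiThm41) (hKim : InputKimCor315)
    (hGZK : InputGZK) :
    Summit.BirchSwinnertonDyer.BirchSwinnertonDyer.Theses.PrintX6.PublishedInputsX6 :=
  ⟨hK12, hK41, hKim,
    SkinnerUrban2014.realPeriodRat_eq_unit_mul_plusPeriod_of_mazur hMazur,
    SkinnerUrban2014.realPeriodRat_eq_unit_mul_plusPeriod_three_of_mazur hMazur,
    Wuthrich2014.lemma20_surjective_threeAdic_of_semistable_holds,
    ModularForms.nonempty_modularParametrizationData_of_exists_isNewformOf hmod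
      ModularForms.IsNewformOf.exists_maninConstant_ne_zero_holds,
    WeierstrassCurve.hasEntireLFunction_rat_of_exists_isNewformOf hmod,
    hGZK⟩

/-- **`PublishedInputsX6` from six displayed inputs, modularity in the pack's own form**: as
`publishedInputsX6_of_slim` but with the Modularity Theorem displayed as the pack's own conjunct (7),
the parametrisation datum `InputModularParametrization` (item 19266); the newform is recovered by
`ModularForms.exists_isNewformOf_of_nonempty_modularParametrizationData` (BCDT 2001 p. 845,
(6) ⇒ (2), a tree theorem). Pure glue. [folklore] -/
theorem publishedInputsX6_of_slim_param
    (hparam : InputModularParametrization) (hMazur : InputMazurManinOdd)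
    (hK12 : InputKobayashiThm12) (hK41 : InputKobayashiThm41) (hKim : InputKimCor315)
    (hGZK : InputGZK) :
    Summit.BirchSwinnertonDyer.BirchSwinnertonDyer.Theses.PrintX6.PublishedInputsX6 :=
  publishedInputsX6_of_slim
    (ModularForms.exists_isNewformOf_of_nonempty_modularParametrizationData hparam)
    hMazur hK12 hK41 hKim hGZK

/-- **The slimming is lossless on the modularity display**: conversely the pack `PublishedInputsX6`
returns the newform item `InputNewformExistence` (from its conjunct 7, the parametrisation datum, by
`ModularForms.exists_isNewformOf_of_nonempty_modularParametrizationData`); the other four slim inputs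
`InputKobayashiThm12/41`, `InputKimCor315`, `InputGZK` are its conjuncts 1, 2, 3, 9 verbatim, and of
Mazur Cor. 4.1 the pack records only the two period-unit consequences. [folklore] -/
theorem inputNewformExistence_of_publishedInputsX6
    (h : Summit.BirchSwinnertonDyer.BirchSwinnertonDyer.Theses.PrintX6.PublishedInputsX6) :
    Summit.BirchSwinnertonDyer.BirchSwinnertonDyer.Theses.PrintX6.InputNewformExistence :=
  ModularForms.exists_isNewformOf_of_nonempty_modularParametrizationData h.2.2.2.2.2.2.1

end Summit.BirchSwinnertonDyer.BirchSwinnertonDyer.Theorems
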